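import Summits.HubbardSuperconductivity.HubbardSuperconductivity.Theorems.BalabanIRBirBdGPhaseCoercivityTraceNorm
import Summits.HubbardSuperconductivity.HubbardSuperconductivity.Theorems.BalabanIRBirBdGPhaseCoercivityFourier

/-!
# Route BalabanIR — crux 3 `BirBdGPhaseCoercivity` (item `stmt-HubbardSuperconductivity-2081`):
# V. The frozen Nambu metric in momentum space

Fifth file of the frozen-Nambu-metric reduction. In a plane-wave basis (`A^ = N⁻¹ W A Wᴴ`, file II)
the reference BdG matrix is `X^₀ = [[ξ, Δ], [conj Δ, -ξ]]` with DIAGONAL blocks (symbols `ξ_k ∈ ℝ`,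
`Δ_k ∈ ℂ`), and the frozen metric is `M = N⁻¹ W₂ᴴ (E ⊕ E) W₂`, `E_k = √(ξ_k² + |Δ_k|²) > 0`,
`W₂ = W ⊕ W`. This file checks the hypotheses of the deficit bound of file I — `M ≻ 0`,
`[X₀, M] = 0`, `M² = X₀²` (`|[[ξ,Δ],[conj Δ,-ξ]]| = E·1₂` momentum by momentum) — and evaluates its
left-hand side for any `X` whose plane-wave form is `[[ξ, D^], [D^ᴴ, -ξ]]`:
`Re Tr (M⁻¹ (X₀² - X²)) = 2 Σ_k |Δ_k|²/E_k - Σ_{k,k'} (|D^_{kk'}|² + |D^_{k'k}|²)/E_k`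
(the `ξ²` terms cancel and the particle–hole off-diagonal blocks of `X²` are traceless against the
block-diagonal metric), whence `frozen_metric_deficit_le`.

References: crux ideas `frozen-nambu-metric`, `sqrt-concavity-multiplier` (Cruxes/BirBdGPhaseCoercivity);
T. Kennedy, E. H. Lieb, Physica A 138 (1986) 320 (the same block bookkeeping for `Tr√(T² + U²)`).
No definition is introduced.
-/

noncomputable section

namespace Summit.HubbardSuperconductivity.HubbardSuperconductivity.Theorems

namespace BirBdG

open Matrix Finset
open scoped ComplexConjugate ComplexOrder

variable {m : Type*} [Fintype m] [DecidableEq m]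

/-! ### Momentum-space Nambu algebra with diagonal blocks -/

/-- `[[ξ,Δ],[conj Δ,-ξ]]` commutes with `E ⊕ E` when all blocks are diagonal. [folklore] -/
theorem nambuHat_comm (ξ E : m → ℝ) (Δ : m → ℂ) :
    Matrix.fromBlocks (diagonal fun k => (ξ k : ℂ)) (diagonal Δ) (diagonal Δ)ᴴ
        (-diagonal fun k => (ξ k : ℂ)) *
      Matrix.fromBlocks (diagonal fun k => (E k : ℂ)) 0 0 (diagonal fun k => (E k : ℂ)) =
    Matrix.fromBlocks (diagonal fun k => (E k : ℂ)) 0 0 (diagonal fun k => (E k : ℂ)) *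
      Matrix.fromBlocks (diagonal fun k => (ξ k : ℂ)) (diagonal Δ) (diagonal Δ)ᴴ
        (-diagonal fun k => (ξ k : ℂ)) := by
  rw [Matrix.fromBlocks_multiply, Matrix.fromBlocks_multiply, Matrix.diagonal_conjTranspose]
  simp only [Matrix.mul_zero, Matrix.zero_mul, add_zero, zero_add, Matrix.diagonal_mul_diagonal,
    Matrix.diagonal_neg]
  congr 1 <;> (try congr 1) <;> funext k <;> simp [mul_comm]

/-- `(E ⊕ E)² = [[ξ,Δ],[conj Δ,-ξ]]²` when `E² = ξ² + |Δ|²` (all blocks diagonal): the momentum-space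
form of `|Hb(0)| = E ⊕ E`. [folklore] -/
theorem nambuHat_sq (ξ E : m → ℝ) (Δ : m → ℂ) (hE : ∀ k, E k ^ 2 = ξ k ^ 2 + ‖Δ k‖ ^ 2) :
    Matrix.fromBlocks (diagonal fun k => (E k : ℂ)) 0 0 (diagonal fun k => (E k : ℂ)) *
      Matrix.fromBlocks (diagonal fun k => (E k : ℂ)) 0 0 (diagonal fun k => (E k : ℂ)) =
    Matrix.fromBlocks (diagonal fun k => (ξ k : ℂ)) (diagonal Δ) (diagonal Δ)ᴴ
        (-diagonal fun k => (ξ k : ℂ)) *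
      Matrix.fromBlocks (diagonal fun k => (ξ k : ℂ)) (diagonal Δ) (diagonal Δ)ᴴ
        (-diagonal fun k => (ξ k : ℂ)) := by
  have hsq : ∀ k, (E k : ℂ) * (E k : ℂ) = (ξ k : ℂ) * (ξ k : ℂ) + Δ k * star (Δ k) := by
    intro k
    rw [Complex.star_def, Complex.mul_conj, Complex.normSq_eq_norm_sq, ← sq, ← sq]
    have h' := congrArg (fun r : ℝ => (r : ℂ)) (hE k)
    push_cast at h' ⊢
    exact h'
  rw [Matrix.fromBlocks_multiply, Matrix.fromBlocks_multiply, Matrix.diagonal_conjTranspose]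
  simp only [Matrix.mul_zero, Matrix.zero_mul, add_zero, zero_add, Matrix.diagonal_mul_diagonal,
    Matrix.diagonal_neg]
  refine Matrix.fromBlocks_inj.2 ⟨?_, ?_, ?_, ?_⟩
  · ext i j
    simp only [Matrix.add_apply, Matrix.diagonal_apply]
    split_ifs with h
    · subst h; exact hsq i
    · simp
  · ext i j
    simp only [Matrix.add_apply, Matrix.diagonal_apply, Matrix.zero_apply]
    split_ifs with h
    · ring
    · simp
  · ext i j
    simp only [Matrix.add_apply, Matrix.diagonal_apply, Matrix.zero_apply, Pi.star_apply]
    split_ifs with h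
    · ring
    · simp
  · ext i j
    simp only [Matrix.add_apply, Matrix.diagonal_apply, Pi.star_apply]
    split_ifs with h
    · subst h; rw [hsq i]; ring
    · simp

/-- `(E ⊕ E)(E⁻¹ ⊕ E⁻¹) = 1` for a nowhere-vanishing real `E`. [folklore] -/
theorem nambuMetricHat_mul_inv (E : m → ℝ) (hE : ∀ k, E k ≠ 0) :
    Matrix.fromBlocks (diagonal fun k => (E k : ℂ)) 0 0 (diagonal fun k => (E k : ℂ)) *
      Matrix.fromBlocks (diagonal fun k => ((E k)⁻¹ : ℂ)) 0 0 (diagonal fun k => ((E k)⁻¹ : ℂ)) = 1 := by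
  rw [Matrix.fromBlocks_multiply]
  simp only [Matrix.mul_zero, Matrix.zero_mul, add_zero, zero_add, Matrix.diagonal_mul_diagonal]
  have : (fun k => (E k : ℂ) * ((E k)⁻¹ : ℂ)) = fun _ => (1 : ℂ) := by
    funext k
    exact mul_inv_cancel₀ (by exact_mod_cast hE k)
  rw [this, Matrix.diagonal_one, Matrix.fromBlocks_one]

/-- Trace against a diagonal matrix: `Tr (diagonal κ * B) = Σ_k κ_k B_{kk}`. [folklore] -/
theorem trace_diagonal_mul' (κ : m → ℂ) (B : Matrix m m ℂ) :
    (diagonal κ * B).trace = ∑ k, κ k * B k k := by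
  simp only [Matrix.trace, Matrix.diag_apply, Matrix.diagonal_mul]

/-- **The one-loop trace in momentum space.** For the block-diagonal multiplier `K^ ⊕ K^`,
`K^ = diagonal κ`, and `X^ = [[A, D^], [D^ᴴ, -A]]` with `A = diagonal a`,
`Tr ((K^ ⊕ K^) X^²) = 2 Σ_k κ_k a_k² + Σ_{k,k'} κ_k (|D^_{kk'}|² + |D^_{k'k}|²)`: the off-diagonal
blocks `A D^ - D^ A` of `X^²` do not meet the trace. [folklore] -/
theorem trace_blockDiag_mul_nambu_sq (κ a : m → ℂ) (Dh : Matrix m m ℂ) :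
    (Matrix.fromBlocks (diagonal κ) 0 0 (diagonal κ) *
        (Matrix.fromBlocks (diagonal a) Dh Dhᴴ (-diagonal a) *
          Matrix.fromBlocks (diagonal a) Dh Dhᴴ (-diagonal a))).trace =
      2 * ∑ k, κ k * (a k * a k) +
        ∑ k, ∑ k', κ k * (((‖Dh k k'‖ ^ 2 + ‖Dh k' k‖ ^ 2 : ℝ) : ℂ)) := by
  rw [Matrix.fromBlocks_multiply, Matrix.fromBlocks_multiply]
  rw [show ∀ (A B C D : Matrix m m ℂ), (Matrix.fromBlocks A B C D).trace = A.trace + D.trace from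
    fun A B C D => by simp [Matrix.trace, Fintype.sum_sum_type]]
  simp only [Matrix.zero_mul, add_zero, zero_add, neg_mul_neg]
  rw [Matrix.mul_add, Matrix.mul_add, Matrix.trace_add, Matrix.trace_add, trace_diagonal_mul',
    trace_diagonal_mul', trace_diagonal_mul']
  have hd : ∀ k, (diagonal a * diagonal a) k k = a k * a k := by
    intro k
    rw [Matrix.diagonal_mul_diagonal, Matrix.diagonal_apply_eq]
  have h1 : ∀ k, (Dh * Dhᴴ) k k = ∑ k', (((‖Dh k k'‖ ^ 2 : ℝ)) : ℂ) := by
    intro k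
    rw [Matrix.mul_apply]
    refine Finset.sum_congr rfl fun k' _ => ?_
    rw [Matrix.conjTranspose_apply, Complex.star_def, Complex.mul_conj, Complex.normSq_eq_norm_sq]
  have h2 : ∀ k, (Dhᴴ * Dh) k k = ∑ k', (((‖Dh k' k‖ ^ 2 : ℝ)) : ℂ) := by
    intro k
    rw [Matrix.mul_apply]
    refine Finset.sum_congr rfl fun k' _ => ?_
    rw [Matrix.conjTranspose_apply, Complex.star_def, mul_comm, Complex.mul_conj,
      Complex.normSq_eq_norm_sq]
  have hsum1 : ∑ k, κ k * (Dh * Dhᴴ) k k = ∑ k, ∑ k', κ k * (((‖Dh k k'‖ ^ 2 : ℝ)) : ℂ) :=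
    Finset.sum_congr rfl fun k _ => by rw [h1 k, Finset.mul_sum]
  have hsum2 : ∑ k, κ k * (Dhᴴ * Dh) k k = ∑ k, ∑ k', κ k * (((‖Dh k' k‖ ^ 2 : ℝ)) : ℂ) :=
    Finset.sum_congr rfl fun k _ => by rw [h2 k, Finset.mul_sum]
  have hsumd : ∑ k, κ k * (diagonal a * diagonal a) k k = ∑ k, κ k * (a k * a k) :=
    Finset.sum_congr rfl fun k _ => by rw [hd k]
  rw [hsum1, hsum2, hsumd]
  have hsum3 : ∑ k, ∑ k', κ k * (((‖Dh k k'‖ ^ 2 + ‖Dh k' k‖ ^ 2 : ℝ) : ℂ)) =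
      ∑ k, ∑ k', κ k * (((‖Dh k k'‖ ^ 2 : ℝ)) : ℂ) + ∑ k, ∑ k', κ k * (((‖Dh k' k‖ ^ 2 : ℝ)) : ℂ) := by
    rw [← Finset.sum_add_distrib]
    refine Finset.sum_congr rfl fun k _ => ?_
    rw [← Finset.sum_add_distrib]
    refine Finset.sum_congr rfl fun k' _ => ?_
    push_cast
    ring
  rw [hsum3]
  ring

/-! ### Transfer to position space -/

section Transfer

variable {W : Matrix m m ℂ} {N : ℕ}

/-- **The frozen Nambu metric is positive definite**: `M = N⁻¹ W₂ᴴ (E ⊕ E) W₂ ≻ 0` for `E > 0`. [folklore] -/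
theorem frozenMetric_posDef (hN : N ≠ 0) (h1 : Wᴴ * W = (N : ℂ) • (1 : Matrix m m ℂ))
    (E : m → ℝ) (hE : ∀ k, 0 < E k) :
    ((N : ℂ)⁻¹ • ((Matrix.fromBlocks W 0 0 W)ᴴ *
        Matrix.fromBlocks (diagonal fun k => (E k : ℂ)) 0 0 (diagonal fun k => (E k : ℂ)) *
        Matrix.fromBlocks W 0 0 W)).PosDef := by
  refine posDef_unhat hN (fromBlocks_conjTranspose_mul_self h1) ?_
  rw [Matrix.fromBlocks_diagonal]
  refine Matrix.PosDef.diagonal fun i => ?_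
  rcases i with k | k <;> simpa using Complex.zero_lt_real.2 (hE k)

/-- **The frozen metric commutes with the reference and squares to its square**: if the
plane-wave form of `X₀` is `[[ξ,Δ],[conj Δ,-ξ]]` (diagonal blocks) and `E² = ξ² + |Δ|²`, then
`X₀ M = M X₀` and `M² = X₀²` for `M = N⁻¹ W₂ᴴ (E ⊕ E) W₂`. [folklore] -/
theorem frozenMetric_comm_and_sq (hN : N ≠ 0) (h1 : Wᴴ * W = (N : ℂ) • (1 : Matrix m m ℂ))
    (h2 : W * Wᴴ = (N : ℂ) • (1 : Matrix m m ℂ)) (ξ E : m → ℝ) (Δ : m → ℂ)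
    (hE : ∀ k, E k ^ 2 = ξ k ^ 2 + ‖Δ k‖ ^ 2) (X₀ : Matrix (m ⊕ m) (m ⊕ m) ℂ)
    (hX₀ : (N : ℂ)⁻¹ • (Matrix.fromBlocks W 0 0 W * X₀ * (Matrix.fromBlocks W 0 0 W)ᴴ) =
      Matrix.fromBlocks (diagonal fun k => (ξ k : ℂ)) (diagonal Δ) (diagonal Δ)ᴴ
        (-diagonal fun k => (ξ k : ℂ))) :
    X₀ * ((N : ℂ)⁻¹ • ((Matrix.fromBlocks W 0 0 W)ᴴ *
        Matrix.fromBlocks (diagonal fun k => (E k : ℂ)) 0 0 (diagonal fun k => (E k : ℂ)) *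
        Matrix.fromBlocks W 0 0 W)) =
      ((N : ℂ)⁻¹ • ((Matrix.fromBlocks W 0 0 W)ᴴ *
        Matrix.fromBlocks (diagonal fun k => (E k : ℂ)) 0 0 (diagonal fun k => (E k : ℂ)) *
        Matrix.fromBlocks W 0 0 W)) * X₀ ∧
    ((N : ℂ)⁻¹ • ((Matrix.fromBlocks W 0 0 W)ᴴ *
        Matrix.fromBlocks (diagonal fun k => (E k : ℂ)) 0 0 (diagonal fun k => (E k : ℂ)) *
        Matrix.fromBlocks W 0 0 W)) *
      ((N : ℂ)⁻¹ • ((Matrix.fromBlocks W 0 0 W)ᴴ *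
        Matrix.fromBlocks (diagonal fun k => (E k : ℂ)) 0 0 (diagonal fun k => (E k : ℂ)) *
        Matrix.fromBlocks W 0 0 W)) = X₀ * X₀ := by
  have h1₂ := fromBlocks_conjTranspose_mul_self (W := W) h1
  have h2₂ := fromBlocks_mul_conjTranspose_self (W := W) h2
  set W₂ : Matrix (m ⊕ m) (m ⊕ m) ℂ := Matrix.fromBlocks W 0 0 W with hW₂
  set Mh : Matrix (m ⊕ m) (m ⊕ m) ℂ :=
    Matrix.fromBlocks (diagonal fun k => (E k : ℂ)) 0 0 (diagonal fun k => (E k : ℂ)) with hMh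
  have hM : (N : ℂ)⁻¹ • (W₂ * ((N : ℂ)⁻¹ • (W₂ᴴ * Mh * W₂)) * W₂ᴴ) = Mh := hat_unhat hN h2₂ Mh
  constructor
  · apply hat_injective hN h1₂
    rw [← hat_mul hN h1₂, ← hat_mul hN h1₂, hM, hX₀, hMh]
    exact nambuHat_comm ξ E Δ
  · apply hat_injective hN h1₂
    rw [← hat_mul hN h1₂, ← hat_mul hN h1₂, hM, hX₀, hMh]
    exact nambuHat_sq ξ E Δ hE

/-- **Inverse of the frozen metric**: `M⁻¹ = N⁻¹ W₂ᴴ (E⁻¹ ⊕ E⁻¹) W₂`. [folklore] -/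
theorem frozenMetric_inv (hN : N ≠ 0) (h1 : Wᴴ * W = (N : ℂ) • (1 : Matrix m m ℂ))
    (h2 : W * Wᴴ = (N : ℂ) • (1 : Matrix m m ℂ)) (E : m → ℝ) (hE : ∀ k, E k ≠ 0) :
    ((N : ℂ)⁻¹ • ((Matrix.fromBlocks W 0 0 W)ᴴ *
        Matrix.fromBlocks (diagonal fun k => (E k : ℂ)) 0 0 (diagonal fun k => (E k : ℂ)) *
        Matrix.fromBlocks W 0 0 W))⁻¹ =
      (N : ℂ)⁻¹ • ((Matrix.fromBlocks W 0 0 W)ᴴ *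
        Matrix.fromBlocks (diagonal fun k => ((E k)⁻¹ : ℂ)) 0 0 (diagonal fun k => ((E k)⁻¹ : ℂ)) *
        Matrix.fromBlocks W 0 0 W) := by
  have h1₂ := fromBlocks_conjTranspose_mul_self (W := W) h1
  have h2₂ := fromBlocks_mul_conjTranspose_self (W := W) h2
  set W₂ : Matrix (m ⊕ m) (m ⊕ m) ℂ := Matrix.fromBlocks W 0 0 W with hW₂
  apply Matrix.inv_eq_right_inv
  -- `unhat` is multiplicative: apply `hat_mul` to `W₂ᴴ`
  have h2' : (W₂ᴴ)ᴴ * W₂ᴴ = (N : ℂ) • (1 : Matrix (m ⊕ m) (m ⊕ m) ℂ) := by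
    rwa [Matrix.conjTranspose_conjTranspose]
  have hmul := hat_mul (W := W₂ᴴ) hN h2'
    (Matrix.fromBlocks (diagonal fun k => (E k : ℂ)) 0 0 (diagonal fun k => (E k : ℂ)))
    (Matrix.fromBlocks (diagonal fun k => ((E k)⁻¹ : ℂ)) 0 0 (diagonal fun k => ((E k)⁻¹ : ℂ)))
  rw [Matrix.conjTranspose_conjTranspose] at hmul
  rw [hmul, nambuMetricHat_mul_inv E hE]
  have hone := hat_one (W := W₂ᴴ) hN (by rwa [Matrix.conjTranspose_conjTranspose])
  rwa [Matrix.conjTranspose_conjTranspose] at hone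

/-- **The one-loop trace of the frozen metric.** With `M = N⁻¹ W₂ᴴ (E ⊕ E) W₂`,
`E² = ξ² + |Δ|²`, `E > 0`, the reference `X₀` of plane-wave form `[[ξ,Δ],[conj Δ,-ξ]]` and any `X`
of plane-wave form `[[ξ, D^], [D^ᴴ, -ξ]]`:
`Re Tr (M⁻¹ (X₀² - X²)) = 2 Σ_k |Δ_k|²/E_k - Σ_{k,k'} (|D^_{kk'}|² + |D^_{k'k}|²)/E_k`. [folklore] -/
theorem frozenMetric_re_trace (hN : N ≠ 0) (h1 : Wᴴ * W = (N : ℂ) • (1 : Matrix m m ℂ))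
    (h2 : W * Wᴴ = (N : ℂ) • (1 : Matrix m m ℂ)) (ξ E : m → ℝ) (Δ : m → ℂ)
    (hE : ∀ k, E k ^ 2 = ξ k ^ 2 + ‖Δ k‖ ^ 2) (hEpos : ∀ k, 0 < E k)
    (X₀ X : Matrix (m ⊕ m) (m ⊕ m) ℂ) (Dh : Matrix m m ℂ)
    (hX₀ : (N : ℂ)⁻¹ • (Matrix.fromBlocks W 0 0 W * X₀ * (Matrix.fromBlocks W 0 0 W)ᴴ) =
      Matrix.fromBlocks (diagonal fun k => (ξ k : ℂ)) (diagonal Δ) (diagonal Δ)ᴴ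
        (-diagonal fun k => (ξ k : ℂ)))
    (hX : (N : ℂ)⁻¹ • (Matrix.fromBlocks W 0 0 W * X * (Matrix.fromBlocks W 0 0 W)ᴴ) =
      Matrix.fromBlocks (diagonal fun k => (ξ k : ℂ)) Dh Dhᴴ (-diagonal fun k => (ξ k : ℂ))) :
    ((((N : ℂ)⁻¹ • ((Matrix.fromBlocks W 0 0 W)ᴴ *
        Matrix.fromBlocks (diagonal fun k => (E k : ℂ)) 0 0 (diagonal fun k => (E k : ℂ)) *
        Matrix.fromBlocks W 0 0 W))⁻¹ * (X₀ * X₀ - X * X)).trace).re =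
      2 * ∑ k, ‖Δ k‖ ^ 2 / E k - ∑ k, ∑ k', (‖Dh k k'‖ ^ 2 + ‖Dh k' k‖ ^ 2) / E k := by
  have hEne : ∀ k, E k ≠ 0 := fun k => (hEpos k).ne'
  have h1₂ := fromBlocks_conjTranspose_mul_self (W := W) h1
  have h2₂ := fromBlocks_mul_conjTranspose_self (W := W) h2
  obtain ⟨-, hsq⟩ := frozenMetric_comm_and_sq hN h1 h2 ξ E Δ hE X₀ hX₀
  rw [frozenMetric_inv hN h1 h2 E hEne]
  set W₂ : Matrix (m ⊕ m) (m ⊕ m) ℂ := Matrix.fromBlocks W 0 0 W with hW₂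
  set Mh : Matrix (m ⊕ m) (m ⊕ m) ℂ :=
    Matrix.fromBlocks (diagonal fun k => (E k : ℂ)) 0 0 (diagonal fun k => (E k : ℂ)) with hMh
  set Kh : Matrix (m ⊕ m) (m ⊕ m) ℂ :=
    Matrix.fromBlocks (diagonal fun k => ((E k)⁻¹ : ℂ)) 0 0 (diagonal fun k => ((E k)⁻¹ : ℂ))
    with hKh
  set M : Matrix (m ⊕ m) (m ⊕ m) ℂ := (N : ℂ)⁻¹ • (W₂ᴴ * Mh * W₂) with hMdef
  set K : Matrix (m ⊕ m) (m ⊕ m) ℂ := (N : ℂ)⁻¹ • (W₂ᴴ * Kh * W₂) with hKdef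
  have hKhat : (N : ℂ)⁻¹ • (W₂ * K * W₂ᴴ) = Kh := hat_unhat hN h2₂ Kh
  have hMhat : (N : ℂ)⁻¹ • (W₂ * M * W₂ᴴ) = Mh := hat_unhat hN h2₂ Mh
  -- `K X₀² = K M² = M` (as `K = M⁻¹`)
  have hKM : K * M = 1 := by
    have := frozenMetric_inv hN h1 h2 E hEne
    rw [← hW₂] at this
    change M⁻¹ = K at this
    rw [← this]
    exact Matrix.nonsing_inv_mul M
      ((Matrix.isUnit_iff_isUnit_det M).1 (frozenMetric_posDef hN h1 E hEpos).isUnit)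
  have hsplit : K * (X₀ * X₀ - X * X) = M - K * (X * X) := by
    rw [Matrix.mul_sub, ← hsq, ← Matrix.mul_assoc, hKM, Matrix.one_mul]
  rw [hsplit, Matrix.trace_sub, Complex.sub_re]
  -- `Tr M = Tr M^ = 2 Σ E`
  have htrM : M.trace = 2 * ∑ k, (E k : ℂ) := by
    rw [← trace_hat hN h1₂ M, hMhat, hMh]
    rw [show ∀ (A B C D : Matrix m m ℂ), (Matrix.fromBlocks A B C D).trace = A.trace + D.trace from
      fun A B C D => by simp [Matrix.trace, Fintype.sum_sum_type]]
    rw [Matrix.trace_diagonal, two_mul]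
  -- `Tr (K X²) = Tr (K^ X^²)`
  have htrK : (K * (X * X)).trace =
      2 * ∑ k, ((E k)⁻¹ : ℂ) * ((ξ k : ℂ) * (ξ k : ℂ)) +
        ∑ k, ∑ k', ((E k)⁻¹ : ℂ) * (((‖Dh k k'‖ ^ 2 + ‖Dh k' k‖ ^ 2 : ℝ) : ℂ)) := by
    rw [← trace_hat hN h1₂ (K * (X * X)), ← hat_mul hN h1₂, ← hat_mul hN h1₂, hKhat, hX, hKh]
    exact trace_blockDiag_mul_nambu_sq _ _ Dh
  rw [htrM, htrK]
  -- real parts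
  have hgap : ∀ k, ‖Δ k‖ ^ 2 / E k = E k - (E k)⁻¹ * (ξ k * ξ k) := by
    intro k
    have hk := hEne k
    rw [eq_sub_iff_add_eq]
    field_simp
    nlinarith [hE k]
  have hreal : (2 * ∑ k, (E k : ℂ)) - (2 * ∑ k, ((E k)⁻¹ : ℂ) * ((ξ k : ℂ) * (ξ k : ℂ)) +
      ∑ k, ∑ k', ((E k)⁻¹ : ℂ) * (((‖Dh k k'‖ ^ 2 + ‖Dh k' k‖ ^ 2 : ℝ) : ℂ))) =
      ((2 * ∑ k, E k - (2 * ∑ k, (E k)⁻¹ * (ξ k * ξ k) +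
        ∑ k, ∑ k', (E k)⁻¹ * (‖Dh k k'‖ ^ 2 + ‖Dh k' k‖ ^ 2)) : ℝ) : ℂ) := by
    push_cast
    rfl
  rw [← Complex.sub_re, hreal, Complex.ofReal_re]
  simp_rw [hgap, Finset.sum_sub_distrib, div_eq_inv_mul]
  ring

end Transfer

end BirBdG

end Summit.HubbardSuperconductivity.HubbardSuperconductivity.Theorems

end
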